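import Mathlib
import Literature.Geometry.Lorentzian.KerrWaveEnergyProofs
import HarnessLib

/-!
# KerrHorizonRegularWaveBoundedness

Topic `Literature/Geometry/Lorentzian`. Named literature fact(s) relocated by the gate from `Summits/FinalStateConjecture/FinalStateConjecture/Theorems/ZeroEnergyKerrOrBombKerrModeStabilityLeaf.lean`
(accept-time relocation of `[cite]`d propositions written inline in a Summits proposal; human ruling 2026-08-15).
Sources: DafermosRodnianskiShlapentokhrothman2014.

* `Literature.Geometry.Lorentzian.DafermosRodnianskiShlapentokhRothman2016_energyBoundedness_horizonRegular`
-/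

namespace Literature.Geometry.Lorentzian

open Literature.Geometry.Lorentzian Set Filter MeasureTheory
open scoped Manifold ContDiff Topology ENNReal

/-- **Dafermos–Rodnianski–Shlapentokh-Rothman, uniform energy boundedness through admissible
hypersurfaces, for solutions regular across the future event horizon** (arXiv:1402.7034 =
Ann. of Math. 183 (2016), Thm. 3.1, estimate (23): `∫_{Σ_τ} J^N_μ[ψ] n^μ_{Σ_τ} ≤
C ∫_{Σ₀} J^N_μ[ψ] n^μ_{Σ₀}` for all `τ ≥ 0` and "all sufficiently regular solutions `ψ` of the wave
equation `□_{g_{a,M}} ψ = 0` on `𝓡₀`", `𝓡₀ = ⋃_{τ≥0} Σ_τ ⊂ 𝓡 = [0,∞) × ℝ × 𝕊²`, `∂𝓡 = 𝓗⁺`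
(§2.1.1, §2.2.5), reduced in §4.1 to solutions "arising from smooth, compactly supported initial
data on `Σ₀`" — data supported on the hypersurface-with-boundary `Σ₀`, in general non-zero at the
horizon sphere `Σ₀ ∩ 𝓗⁺`; in the generalised form of §3.3, p. 14: "Theorems 3.1 and 3.2 hold where
`Σ₀` is replaced by an arbitrary admissible hypersurface `Σ̃₀`, `Σ_τ` by `Σ̃_τ ≐ φ_τ(Σ̃₀)`",
proven as Prop. 4.6.1 of arXiv:1010.5132, constant `C = C(M, a, Σ̃₀)`). **Vendored form**: for
subextremal `(M, a)`, an inner radius `r₋ < r₀ < r₊` and every admissible height function `F`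
(`Kerr.IsAdmissibleHeight M F`: Kerr–Schild graph `Σ̃₀ = {t* = F(y)}`, admissible of the first
kind) there is `C = C(M, a, r₀, F) < ∞` such that every smooth `ψ : Kerr.region a r₀ → ℝ`
(horizon-penetrating ingoing Kerr–Schild chart `{r > r₀}`, smooth across `𝓗⁺ = {r = r₊}`) which
solves `□_g ψ = 0` at all points with `r > r₊` (hence on `{r ≥ r₊}` by continuity; nothing is
imposed inside the black hole, where the source imposes nothing) and whose data `(ψ, dψ)` vanish at
all graph points `{x⁰ = F(x⃗)}` with `‖x⃗‖ > ρ`, for some `ρ` (compact support on `Σ̃₀` towards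
infinity only), satisfies `E_F(τ) ≤ C · E_F(0)` for all `τ ≥ 0`, where
`E_F(τ) = graphSliceEnergy (Kerr.exterior M a) ψ|_{r > r₊} F τ` is the coordinate energy of the
restriction of `ψ` to the exterior chart through `Σ̃_τ ∩ {r > r₊} = {t* = τ + F, r > r₊}`
(comparable to `∫_{Σ̃_τ} J^N_μ n^μ` with constants depending on `(M, a)` and the slope bound of
`F`: the graphs are uniformly spacelike up to and through `𝓗⁺`, arXiv:1402.7034, display after
(23)). The sub-case of data supported in the open exterior graph is
`DafermosRodnianskiShlapentokhRothman2016_energyBoundedness` of `KerrWaveEnergy.lean`, whose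
docstring (choice of `N`, role of the slope bound, the untranscribed clause "for all `|a'| ≤ a₀`" of
Def. 4.1 (i) of arXiv:1010.5132) applies verbatim; that fact is not formally a special case of this
one (its solutions need not extend across `𝓗⁺`). The 130-page proof (frequency-localised multipliers
for Carter's separated equations, mode stability, continuity in `a`, red-shift) is not reproduced:
this is a named fact (D-0014).
[cite: DafermosRodnianskiShlapentokhrothman2014, Thm. 3.1 (23) with §3.3 (p. 14) and §4.1, §2.2.5]
[file Geometry/Lorentzian/KerrHorizonRegularWaveBoundedness] -/
def DafermosRodnianskiShlapentokhRothman2016_energyBoundedness_horizonRegular : Prop :=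
  ∀ [Kerr.Facts] [Kerr.SliceFacts] (M a r₀ : ℝ) (hr : r₀ < Kerr.rPlus M a),
    Kerr.IsSubextremal M a → Kerr.rMinus M a < r₀ →
    ∀ F : E3 → ℝ, Kerr.IsAdmissibleHeight M F →
      ∃ C : ℝ≥0∞, C < ⊤ ∧ ∀ ψ : Kerr.region a r₀ → ℝ,
        ContMDiff 𝓘(ℝ, E4) 𝓘(ℝ, ℝ) ∞ ψ →
        (∀ x : Kerr.region a r₀, Kerr.rPlus M a < Kerr.radius a (x : E4) →
          (Kerr.smoothMetric M a r₀).toPseudoRiemannianMetric.dalembertian ψ x = 0) →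
        (∃ ρ : ℝ, ∀ x : Kerr.region a r₀, (x : E4) 0 = F (E4.spatial (x : E4)) →
            ρ < E4.spatialNorm (x : E4) → ψ x = 0 ∧ mfderiv 𝓘(ℝ, E4) 𝓘(ℝ, ℝ) ψ x = 0) →
        ∀ τ : ℝ, 0 ≤ τ →
          graphSliceEnergy (Kerr.exterior M a)
              (fun y : Kerr.exterior M a ↦ ψ ⟨(y : E4), Kerr.region_mono a hr.le y.2⟩) F τ ≤
            C * graphSliceEnergy (Kerr.exterior M a)
              (fun y : Kerr.exterior M a ↦ ψ ⟨(y : E4), Kerr.region_mono a hr.le y.2⟩) F 0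

end Literature.Geometry.Lorentzian
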